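import Summits.Ventures.HodgeRepro2.T6A2WeilPsi

/-!
# T6A2WeilSurface — the surface shadow `HS`, `f^*`, `∫_S`, and the Gysin class `z` on the host

Cell pub-hodge-repro2, Tier 6 (README §10), seat t6-p2 (A2 host side; continues T6A2WeilPsi). The surface
fields of the lead's `ShadowData` (T6InterfaceOfData ll. 76–89: `HS` a `ℂ`-algebra, `pull : HBC K →ₐ[ℂ] HS`,
`intS : HS →ₗ[ℂ] ℂ`, `z : HB K`, `z_deg`, `z_alg`, `z_proj`) on the host Weil cohomology:
* `integralF W P : FullRing W P →ₗ[ℚ] ℚ` — the trace of the top component (`integralF_evenToFull`);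
* `HSW W D := ℂ ⊗[ℚ] FullRing W D.S` — the complexified cohomology ring of the surface (a `ℂ`-algebra);
  `genS` = the base change of `ι₁` (`genS_mul_self`: degree-one classes square to zero, from the Koszul sign);
* `pullS W D A : HBC K →ₐ[ℂ] HSW W D` — `f^*` on the complex exterior algebra, through `φ₁`;
  **`pullS_extC : pullS (extC K u) = 1 ⊗ f^* (evF⁻¹ u)`** (the generators agree: `ExteriorAlgebra.hom_ext`);
* `intSW W D : HSW W D →ₗ[ℂ] ℂ` — `∫_S`, the base change of `integralF`;
* `zW := ev (f_* 1)` with `zW_deg` (`z ∈ H^{20}(B)`: `dim B = 12`, `dim S = 2`, from `push_ofDeg_eq`),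
  `zW_mem_algOf` (`z ∈ Alg 10`, from the accepted `z_mem_Alg`), and **`zW_proj`** — TIER4 (S1)'s projection
  formula `∫_B z ∪ u = ∫_S f^* u` for EVERY `u ∈ HB K` (even `u`: `push_pull_mul` + `integral_push`; odd `u`:
  both sides vanish by degree; glued by `ext_of_forall_degB`).
No `sorry`; standard axioms. §8(d): uses an L-value-free non-vanishing device: NO.
-/

noncomputable section

namespace Summit.Ventures.HodgeRepro2.T6.WeilInst

open HostAPI.Carriers.AlgebraicGeometry.Motives CategoryTheory Opposite
open Summit.Ventures.HodgeRepro2.T6 Summit.Ventures.HodgeRepro2.T6.A2Gysin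
  Summit.Ventures.HodgeRepro2.T6.A2Shadow
open scoped DirectSum TensorProduct

universe u

variable {k : Type u} [Field k] (W : WeilCohomology k ℚ)

section integralF

variable (P : SPVar k)

/-- THE INTEGRAL ON THE FULL RING: the trace of the top-degree component. -/
def integralF : FullRing W P →ₗ[ℚ] ℚ :=
  (W.trace P.X P.n) ∘ₗ (DirectSum.component ℚ ℕ (Full W P.X) (2 * P.n))

/-- the integral of a top-degree class is its trace -/
theorem integralF_ofDegF_top (a : W.obj P.X (2 * P.n)) : integralF W P (ofDegF W P (2 * P.n) a) = W.trace P.X P.n a := by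
  simp [integralF, ofDegF]

/-- the integral kills the homogeneous classes off the top degree -/
theorem integralF_ofDegF_of_ne {i : ℕ} (hi : i ≠ 2 * P.n) (a : W.obj P.X i) : integralF W P (ofDegF W P i a) = 0 := by
  simp only [integralF, ofDegF, LinearMap.comp_apply, DirectSum.component.of, dif_neg hi, map_zero]

/-- the integral of the full ring restricts to the integral of the even ring -/
theorem integralF_evenToFull (x : EvenRing W P) : integralF W P (evenToFull W P x) = integral W P x := by
  induction x using DirectSum.induction_on with
  | zero => simp
  | of i a =>
    rw [← DirectSum.lof_eq_of ℚ]
    change integralF W P (evenToFull W P (ofDeg W P i a)) = integral W P (ofDeg W P i a)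
    rw [evenToFull_ofDeg]
    by_cases hi : i = P.n
    · subst hi; rw [integralF_ofDegF_top, integral_ofDeg_top]
    · rw [integralF_ofDegF_of_ne W P (by omega), integral_ofDeg_of_ne W P hi]
  | add x y hx hy => rw [map_add, map_add, hx, hy, map_add]

/-- degree-one classes anti-commute (the Koszul sign `(−1)^{1·1}`) -/
theorem ι₁_mul_ι₁_anticomm (y y' : W.obj P.X 1) : ι₁ W P y * ι₁ W P y' = -(ι₁ W P y' * ι₁ W P y) := by
  have h := W.cup_comm P.smooth (rfl : 1 + 1 = 1 + 1) rfl y y'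
  have hsign : (((1 : ℕ) * (1 : ℕ) : ℤ).negOnePow : ℤ) = -1 := by decide
  rw [hsign, neg_one_zsmul] at h
  rw [ι₁, ofDegF_mul_ofDegF, ofDegF_mul_ofDegF, h, map_neg]

end integralF

section surface

variable (D : SituationData k)

/-- THE SURFACE SHADOW: the complexified full cohomology ring `H^*(S, ℚ) ⊗ ℂ` of the surface. -/
abbrev HSW := ℂ ⊗[ℚ] FullRing W D.S

example : Ring (HSW W D) := inferInstance
example : Algebra ℂ (HSW W D) := inferInstance

/-- the complexified degree-one inclusion `ℂ ⊗ H¹(S) → HS` -/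
def genS : ℂ ⊗[ℚ] W.obj D.S.X 1 →ₗ[ℂ] HSW W D := (ι₁ W D.S).baseChange ℂ

/-- `genS` on a pure tensor -/
theorem genS_tmul (c : ℂ) (y : W.obj D.S.X 1) : genS W D (c ⊗ₜ y) = c ⊗ₜ ι₁ W D.S y := by
  simp [genS, LinearMap.baseChange_tmul]

/-- complexified degree-one classes anti-commute -/
theorem genS_mul_anticomm (t t' : ℂ ⊗[ℚ] W.obj D.S.X 1) : genS W D t * genS W D t' = -(genS W D t' * genS W D t) := by
  induction t using TensorProduct.induction_on with
  | zero => simp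
  | add t₁ t₂ h₁ h₂ => rw [map_add, add_mul, mul_add, h₁, h₂, neg_add]
  | tmul c y =>
    induction t' using TensorProduct.induction_on with
    | zero => simp
    | add t₁ t₂ h₁ h₂ => rw [map_add, mul_add, add_mul, h₁, h₂, neg_add]
    | tmul c' y' =>
      rw [genS_tmul, genS_tmul, Algebra.TensorProduct.tmul_mul_tmul, Algebra.TensorProduct.tmul_mul_tmul,
        ι₁_mul_ι₁_anticomm, TensorProduct.tmul_neg, mul_comm c']

/-- complexified degree-one classes square to zero -/
theorem genS_mul_self (t : ℂ ⊗[ℚ] W.obj D.S.X 1) : genS W D t * genS W D t = 0 := by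
  have h := genS_mul_anticomm W D t t
  have h2 : (2 : ℚ) • (genS W D t * genS W D t) = 0 := by
    rw [two_smul]
    exact add_eq_zero_iff_eq_neg.2 h
  exact (smul_eq_zero.1 h2).resolve_left two_ne_zero

variable {K : Type*} [Field K] [NumberField K] (A : OrderAction W D.B K)

/-- the coordinate-`i` piece of the generator map: `K → H¹(S)`, `x ↦ f^* φ₁ (x e_i)` -/
def genCoord (i : Fin 4) : K →ₗ[ℚ] W.obj D.S.X 1 :=
  (W.pullback D.f 1) ∘ₗ (A.φ₁ : H1 K →ₗ[ℚ] W.obj D.B.X 1) ∘ₗ LinearMap.single ℚ (fun _ : Fin 4 => K) i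

/-- the generator map `H¹(B, ℂ) = H1C K → ℂ ⊗ H¹(S)`: the base change of `f^* ∘ φ₁`, coordinate by coordinate -/
def genB : H1C K →ₗ[ℂ] ℂ ⊗[ℚ] W.obj D.S.X 1 :=
  ∑ i : Fin 4, ((genCoord W D A i).baseChange ℂ) ∘ₗ LinearMap.proj i

/-- `genB` on the complexification of a rational class -/
theorem genB_h1ToC (v : H1 K) : genB W D A (h1ToC K v) = (1 : ℂ) ⊗ₜ W.pullback D.f 1 (A.φ₁ v) := by
  simp only [genB, LinearMap.sum_apply, LinearMap.comp_apply, LinearMap.proj_apply]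
  have hv : ∀ i : Fin 4, h1ToC K v i = (1 : ℂ) ⊗ₜ v i := fun i => rfl
  simp only [hv, LinearMap.baseChange_tmul]
  rw [← TensorProduct.tmul_sum]
  congr 1
  simp only [genCoord, LinearMap.comp_apply, LinearEquiv.coe_coe]
  rw [← map_sum, ← map_sum]
  have hsum : (∑ i, LinearMap.single ℚ (fun _ : Fin 4 => K) i (v i)) = v := by
    simp only [LinearMap.coe_single]
    exact Finset.univ_sum_single v
  rw [hsum]

/-- THE PULL-BACK `f^* : H^*(B, ℂ) → H^*(S, ℂ)` on the complex exterior algebra, through `φ₁`. -/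
def pullS : HBC K →ₐ[ℂ] HSW W D :=
  ExteriorAlgebra.lift ℂ ⟨(genS W D) ∘ₗ genB W D A, fun _ => genS_mul_self W D _⟩

/-- `pullS` on a generator -/
theorem pullS_ι (w : H1C K) : pullS W D A (ExteriorAlgebra.ι ℂ w) = genS W D (genB W D A w) := by
  simp [pullS]

variable (hL : Function.Bijective (langeMap W D.B))

/-- **`f^*` COMMUTES WITH THE COMPLEXIFICATION**: `pullS (extC u) = 1 ⊗ f^* (evF⁻¹ u)`. -/
theorem pullS_extC (u : HB K) :
    pullS W D A (extC K u) = (1 : ℂ) ⊗ₜ pullF W (P := D.S) (Q := D.B) D.f ((evF W D A hL).symm u) := by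
  have h : ((pullS W D A).restrictScalars ℚ).comp (extC K) =
      (Algebra.TensorProduct.includeRight (R := ℚ) (A := ℂ)).comp
        ((pullF W (P := D.S) (Q := D.B) D.f).comp (evF W D A hL).symm.toAlgHom) := by
    apply ExteriorAlgebra.hom_ext
    refine LinearMap.ext fun v => ?_
    simp only [LinearMap.comp_apply, AlgHom.toLinearMap_apply, AlgHom.comp_apply,
      AlgHom.coe_restrictScalars', AlgEquiv.coe_toAlgHom]
    rw [extC, ExteriorAlgebra.lift_ι_apply, LinearMap.comp_apply, LinearMap.coe_restrictScalars,
      pullS_ι, genB_h1ToC, genS_tmul, evF_symm_apply, ExteriorAlgebra.map_apply_ι, langeMap_ι,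
      Algebra.TensorProduct.includeRight_apply, ι₁, pullF_ofDegF]
    rfl
  exact congrArg (fun g => g u) h

/-- THE INTEGRAL `∫_S : H^*(S, ℂ) → ℂ`: the base change of `integralF`. -/
def intSW : HSW W D →ₗ[ℂ] ℂ :=
  (Algebra.TensorProduct.rid ℚ ℂ ℂ).toLinearEquiv.toLinearMap ∘ₗ (integralF W D.S).baseChange ℂ

/-- `∫_S` on a pure tensor -/
theorem intSW_tmul (c : ℂ) (x : FullRing W D.S) : intSW W D (c ⊗ₜ x) = c * (integralF W D.S x : ℂ) := by
  simp only [intSW, LinearMap.comp_apply, LinearMap.baseChange_tmul, LinearEquiv.coe_coe,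
    AlgEquiv.toLinearEquiv_apply, Algebra.TensorProduct.rid_tmul, Rat.smul_def, mul_comm]

end surface

section z

variable {K : Type*} [Field K] [NumberField K] (D : SituationData k) (hgen : D.HasGens) (hten : D.ProductsSmooth)
  (A : OrderAction W D.B K) (hL : Function.Bijective (langeMap W D.B))

/-- the Gysin class `z = f_* 1` on the host is `push f 1` -/
theorem z_eq_push : D.z W hgen hten = push W (P := D.S) (Q := D.B) D.f 1 := by
  show (D.cycleTheory W hgen hten).gysin _ (X := ⟨0⟩) (Y := ⟨1⟩) D.f 1 = _
  exact gysin_eq_push W D.spaces hgen (pushAlg_of_tensor W D.spaces hgen hten) _ (a := ⟨0⟩) (b := ⟨1⟩) D.f 1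

/-- THE GYSIN CLASS ON THE MODEL: `z := ev (f_* 1)`. -/
def zW : HB K := evOf W D A hL (D.z W hgen hten)

/-- `z ∈ H^{20}(B, ℚ)` (`dim B = 12`, `dim S = 2`) -/
theorem zW_deg (hdimB : D.B.n = 12) (hdimS : D.S.n = 2) : zW W D hgen hten A hL ∈ degB K 20 := by
  rw [zW, z_eq_push, one_def, push_ofDeg_eq W (P := D.S) (Q := D.B) D.f _ (by omega), evOf_eq_evF,
    evenToFull_ofDeg]
  have hq : 0 + D.B.n - D.S.n = 10 := by omega
  rw [hq] at *
  exact evF_ofDegF_mem_degB W D A hL _ _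

/-- `z ∈ Alg 10` (TIER4 (S1)) -/
theorem zW_mem_algOf (hdimB : D.B.n = 12) (hdimS : D.S.n = 2) :
    zW W D hgen hten A hL ∈ (identB W D hgen hten A hL).algOf 10 :=
  ⟨Submodule.subset_span ⟨_, D.z_mem_alg W hgen hten, rfl⟩, zW_deg W D hgen hten A hL hdimB hdimS⟩

/-- `ψ (ev a * u) = a * ψ u` for even `u` -/
theorem psiOf_evOf_mul_even (a : EvenRing W D.B) (j : ℕ) (u : HB K) (hu : u ∈ degB K (2 * j)) :
    psiOf W D A hL (evOf W D A hL a * u) = a * psiOf W D A hL u := by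
  conv_lhs => rw [← evOf_psiOf_even W D A hL j u hu, ← map_mul, psiOf_evOf]

/-- the projection formula on the even ring: `∫_B (f_* 1 ∪ x) = ∫_S f^* x` -/
theorem integral_push_one_mul (x : EvenRing W D.B) :
    integral W D.B (push W (P := D.S) (Q := D.B) D.f 1 * x) = integral W D.S (pull W D.f x) := by
  rw [mul_comm, ← mul_one (pull W D.f x), ← push_pull_mul, mul_one, integral_push]

/-- **THE PROJECTION FORMULA FOR `z` ON THE MODEL** (TIER4 (S1) / Lemma A4.1.1(ii)): for every `u ∈ HB K`,
`∫_B z ∪ u = ∫_S f^* u`, with `∫_B := integral ∘ ψ` and the surface data above. -/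
theorem zW_proj (hdimB : D.B.n = 12) (hdimS : D.S.n = 2) (u : HB K) :
    ((integral W D.B (psiOf W D A hL (zW W D hgen hten A hL * u)) : ℚ) : ℂ) =
      intSW W D (pullS W D A (extC K u)) := by
  -- both sides are ℚ-linear in `u`: compare on the homogeneous pieces
  let L : HB K →ₗ[ℚ] ℂ :=
    (Algebra.linearMap ℚ ℂ) ∘ₗ ((integral W D.B) ∘ₗ (psiOf W D A hL)) ∘ₗ (LinearMap.mulLeft ℚ (zW W D hgen hten A hL))
  let R : HB K →ₗ[ℚ] ℂ :=
    ((intSW W D).restrictScalars ℚ) ∘ₗ ((pullS W D A).toLinearMap.restrictScalars ℚ) ∘ₗ (extC K).toLinearMap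
  have hLR : L = R := by
    refine ext_of_forall_degB K fun j u hu => ?_
    simp only [L, R, LinearMap.comp_apply, Algebra.linearMap_apply, LinearMap.mulLeft_apply,
      LinearMap.coe_restrictScalars, AlgHom.toLinearMap_apply]
    rw [pullS_extC W D A hL, intSW_tmul, one_mul]
    rcases Nat.even_or_odd j with ⟨j', hj⟩ | ⟨j', hj⟩
    · -- even degree: the projection formula
      have hu' : u ∈ degB K (2 * j') := by rw [show 2 * j' = j by omega]; exact hu
      rw [zW, psiOf_evOf_mul_even W D A hL _ j' u hu', z_eq_push, integral_push_one_mul,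
        ← integralF_evenToFull, evenToFull_pull, psiOf_apply,
        evenToFull_fullToEven_of_mem W D.B (evF_symm_mem_range_ofDegF W D A hL hu')]
      exact eq_ratCast _ _
    · -- odd degree: both sides vanish
      have hu' : u ∈ degB K (2 * j' + 1) := by rw [show 2 * j' + 1 = j by omega]; exact hu
      have hzu : zW W D hgen hten A hL * u ∈ degB K (2 * (10 + j') + 1) := by
        have := SetLike.mul_mem_graded (A := fun i : ℕ => ⋀[ℚ]^i (H1 K))
          (zW_deg W D hgen hten A hL hdimB hdimS) hu'
        rw [show 2 * (10 + j') + 1 = 20 + (2 * j' + 1) by omega]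
        exact this
      rw [psiOf_odd W D A hL _ _ hzu, map_zero]
      obtain ⟨y, hy⟩ := evF_symm_mem_range_ofDegF W D A hL hu'
      rw [← hy, pullF_ofDegF, integralF_ofDegF_of_ne W D.S (by omega)]
      simp
  exact congrArg (fun g => g u) hLR

end z

end Summit.Ventures.HodgeRepro2.T6.WeilInst

end
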